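import Mathlib
import Summits.PneNP.PneNP.Theorems.ConvexRankGatesLinAlgGateBlindMonotoneLayer
import Summits.PneNP.PneNP.Theorems.ConvexRankGatesLinAlgGateBlindPluckingBound
import Summits.PneNP.PneNP.Theorems.ConvexRankGatesLinAlgGateBlindDenseRegime

/-!
# Route ConvexRankGates, crux `LinAlgGateBlind` (stmt-PneNP-10681): the TRANSPOSITION DOOR — `SG_PERM` at every `c` for switching-network PERM gates (supports)

The single-gate statement `SGAt` of line `dnf-invariant-wide-gates-see-small-cliques` (the hypothesis
`SG_PERM` of the landed reduction `linAlgGateBlind_of_sgAt`, and the split child `SGPerm` of the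
strategist decomposition `LinAlgGateBlind_of_subs`) is PROVED, for EVERY size exponent `c`, for the
sub-class of `PERM_{m^c}` term gates whose generators are TRANSPOSITIONS (or trivial):
`sgAt_transpositionPerm`. By `mem_closure_image_iff_forall_reachable` such a gate on `d ≤ m^c` points,
fed with clique atoms `⌈X_i⌉` of any fan-in, accepts iff its target `τ` moves every point inside its
connected component of the graph on `Fin d` whose edge `{a, b}` is switched on by the atom-OR
`⌈{X_i : σ_i = (a b)}⌉` — a monotone switching network with `d` nodes (Chan–Potechin's model) read
through clique atoms. Razborov's approximation method is then run SEMANTICALLY along Bellman–Ford: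

* `bellmanFord_step` / `bellmanFord_rounds`: `reach_{t+1}(a,b) = reach_t(a,b) ∨ ⋁_w reach_t(a,w) ∧ e(w,b)`
  is one `ΣΠ`-step per pair (`inv_sigmaPi`), all pairs of a round SHARING one finset of lost `k`-sets
  and one gained event, so a round costs `d³` trimming sets and `d²` plucks — shared sub-results are
  charged once, which no union bound over the gate's truth table can do;
* `sg_transpositionTermGate_of_budget`: after `d` rounds and the output AND `⋀_a reach_d(a, τ a)`
  (`inv_bigAnd`; paths have length `< d`), `#lostPos ≤ (d⁴ + d)·T` and `gainedNeg ≤ (d² + d³)·Pl` for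
  the per-step trimming count `T` (`card_errPos_le_wide`) and plucking mass `Pl` (`stub_pluckingBound`);
* `sgAt_transpositionPerm`: in the line's regime (`stub_denseRegime` at parameter `5c + 1`, i.e.
  `r = rOf (5c+1) m`, both per-step errors `≤ ε_{5c+1}(m)`, and `2 m^{4c} ε_{5c+1}(m) ≤ ε_c(m)`):
  `∀ c, ∀ᶠ m, SGAt m TransPERM(m^c) (lOf m) (kOf m) (qOf m) (epsOf c m)`.

Calibration. Every earlier PERM door of this crux (chain covers, characters, log-width hosts:
`Theorems/ConvexRankGatesLinAlgGateBlind{ChainCover,CommPermSmallDim,LogWidthPerm,…}.lean`) is a union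
bound over maxterms and stops at dimension `d·log d ≤ m^{7/8}/log⁵ m`; this door has no dimension cap. It
does not touch the abelian (`𝔽_p`-span-program) or general nonabelian designs, whose monotone circuit
complexity over their own atoms can be exponential (Göös–Kamath–Robere–Sokolov 2019 for `𝔽₂`-span
programs), so `SG_PERM` stays open exactly there. Sources: A. A. Razborov (1985); N. Alon, R. B. Boppana,
Combinatorica 7 (1987), Thm. 2.1 and §3; R. Bellman, Quart. Appl. Math. 16 (1958); S. M. Chan,
A. Potechin, Theory Comput. 10 (2014) (the model); Mathlib `mem_closure_isSwap`. No new definitions;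
nothing is assumed. [folklore]
-/

-- `Summit.PneNP.PneNP.…` duplicates `PneNP` BY DESIGN (single-problem summit).
set_option linter.dupNamespace false

noncomputable section

namespace Summit.PneNP.PneNP.Theorems

open Finset Filter Literature.Computability.Complexity Razborov
open Summit.PneNP.PneNP.Cruxes.LinAlgGateBlind.DnfInvariantWideGatesSeeSmallCliques

/-! ### Bellman–Ford in the lattice `K(m, r, l)` -/

section BellmanFord

variable {m r l k d : ℕ} {q Pl : ℝ} {T : ℕ}

/-- **One round of Bellman–Ford costs `d³` trimming sets and `d²` plucks.** If all `v a b` and all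
switched edges `e a b` (`a b : Fin d`) carry the wire invariant with common collectors, then so do all
`v' a b = v a b ∨ ⋁_w (v a w ∧ e w b)`, with `d³·T` more lost `k`-sets and `d²·Pl` more gained mass
(`inv_sigmaPi` once per pair `(a, b)`; `C a b` names the joined family before closure). [folklore] -/
theorem bellmanFord_step (hq0 : 0 ≤ q) (hq1 : q ≤ 1)
    (hPl : ∀ 𝒞 : Finset (Finset (Fin m)), 𝒞 ⊆ smallSets (Fin m) l →
      prob q (fun x : KEdge m → Bool => Accepts (closure r l 𝒞) x ∧ ¬ Accepts 𝒞 x) ≤ Pl)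
    (hT : ∀ A B : Finset (Finset (Fin m)), IsClosedFamily r l A → IsClosedFamily r l B →
      #(errPos k A B) ≤ T)
    {e v v' : Fin d → Fin d → (KEdge m → Bool) → Bool} {A F : Fin d → Fin d → Finset (Finset (Fin m))}
    {BadP : Finset (Finset (Fin m))} {BadN : (KEdge m → Bool) → Prop}
    (he : ∀ a b, IsClosedFamily r l (A a b) ∧
      (∀ x : KEdge m → Bool, ¬ BadN x → Accepts (A a b) x → e a b x = true) ∧
      ∀ S : Finset (Fin m), #S = k → e a b (cliqueVec S) = true → Accepts (A a b) (cliqueVec S) ∨ S ∈ BadP)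
    (hv : ∀ a b, IsClosedFamily r l (F a b) ∧
      (∀ x : KEdge m → Bool, ¬ BadN x → Accepts (F a b) x → v a b x = true) ∧
      ∀ S : Finset (Fin m), #S = k → v a b (cliqueVec S) = true → Accepts (F a b) (cliqueVec S) ∨ S ∈ BadP)
    (hv' : ∀ a b x, v' a b x = true ↔
      v a b x = true ∨ ∃ w ∈ (univ : Finset (Fin d)), v a w x = true ∧ e w b x = true)
    (C : Fin d → Fin d → Finset (Finset (Fin m)))
    (hC : ∀ a b, C a b = F a b ∪ (univ : Finset (Fin d)).biUnion fun w => F a w ∩ A w b) :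
    ∃ (F' : Fin d → Fin d → Finset (Finset (Fin m))) (BadP' : Finset (Finset (Fin m)))
      (BadN' : (KEdge m → Bool) → Prop),
      #BadP' ≤ #BadP + d ^ 3 * T ∧ prob q BadN' ≤ prob q BadN + (d : ℝ) ^ 2 * Pl ∧
      (∀ x, BadN x → BadN' x) ∧
      ∀ a b, IsClosedFamily r l (F' a b) ∧
        (∀ x : KEdge m → Bool, ¬ BadN' x → Accepts (F' a b) x → v' a b x = true) ∧
        ∀ S : Finset (Fin m), #S = k → v' a b (cliqueVec S) = true →
          Accepts (F' a b) (cliqueVec S) ∨ S ∈ BadP' := by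
  classical
  have hCsub : ∀ a b, C a b ⊆ smallSets (Fin m) l := fun a b => by
    rw [hC]
    exact union_subset (hv a b).1.subset
      (biUnion_subset.2 fun w _ => inter_subset_left.trans (hv a w).1.subset)
  refine ⟨fun a b => closure r l (C a b),
    BadP ∪ (univ : Finset (Fin d × Fin d × Fin d)).biUnion fun p => errPos k (F p.1 p.2.1) (A p.2.1 p.2.2),
    fun x => BadN x ∨ ∃ ab ∈ (univ : Finset (Fin d × Fin d)),
      Accepts (closure r l (C ab.1 ab.2)) x ∧ ¬ Accepts (C ab.1 ab.2) x,
    ?_, ?_, fun x hx => Or.inl hx, fun a b => ?_⟩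
  · -- lost `k`-sets: `d³` more trimming sets
    have hsum : ∑ p ∈ (univ : Finset (Fin d × Fin d × Fin d)), #(errPos k (F p.1 p.2.1) (A p.2.1 p.2.2))
        ≤ ∑ _p ∈ (univ : Finset (Fin d × Fin d × Fin d)), T :=
      sum_le_sum fun p _ => hT (F p.1 p.2.1) (A p.2.1 p.2.2) (hv p.1 p.2.1).1 (he p.2.1 p.2.2).1
    have hcst : ∑ _p ∈ (univ : Finset (Fin d × Fin d × Fin d)), T = d ^ 3 * T := by
      rw [sum_const, card_univ, Fintype.card_prod, Fintype.card_prod, Fintype.card_fin, smul_eq_mul]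
      ring
    calc #(BadP ∪ (univ : Finset (Fin d × Fin d × Fin d)).biUnion
            fun p => errPos k (F p.1 p.2.1) (A p.2.1 p.2.2))
        ≤ #BadP + #((univ : Finset (Fin d × Fin d × Fin d)).biUnion
            fun p => errPos k (F p.1 p.2.1) (A p.2.1 p.2.2)) := card_union_le _ _
      _ ≤ #BadP + ∑ p ∈ (univ : Finset (Fin d × Fin d × Fin d)),
            #(errPos k (F p.1 p.2.1) (A p.2.1 p.2.2)) := Nat.add_le_add_left card_biUnion_le _
      _ ≤ #BadP + d ^ 3 * T := Nat.add_le_add_left (hsum.trans hcst.le) _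
  · -- gained graphs: `d²` more plucking events
    have hsum : ∑ ab ∈ (univ : Finset (Fin d × Fin d)),
        prob q (fun x : KEdge m → Bool => Accepts (closure r l (C ab.1 ab.2)) x ∧ ¬ Accepts (C ab.1 ab.2) x)
        ≤ ∑ _ab ∈ (univ : Finset (Fin d × Fin d)), Pl :=
      sum_le_sum fun ab _ => hPl (C ab.1 ab.2) (hCsub ab.1 ab.2)
    have hcst : ∑ _ab ∈ (univ : Finset (Fin d × Fin d)), Pl = (d : ℝ) ^ 2 * Pl := by
      rw [sum_const, card_univ, Fintype.card_prod, Fintype.card_fin, nsmul_eq_mul]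
      push_cast; ring
    have hex := prob_exists_le hq0 hq1 (univ : Finset (Fin d × Fin d))
      (fun (ab : Fin d × Fin d) (x : KEdge m → Bool) =>
        Accepts (closure r l (C ab.1 ab.2)) x ∧ ¬ Accepts (C ab.1 ab.2) x)
    have hor := prob_or_le hq0 hq1 BadN (fun x : KEdge m → Bool =>
      ∃ ab ∈ (univ : Finset (Fin d × Fin d)), Accepts (closure r l (C ab.1 ab.2)) x ∧ ¬ Accepts (C ab.1 ab.2) x)
    linarith
  · -- the invariant of `v' a b`: one `ΣΠ`-step
    have h := inv_sigmaPi (univ : Finset (Fin d)) (hv a b) (fun w _ => hv a w) (fun w _ => he w b) (hv' a b)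
      (BadP' := BadP ∪ (univ : Finset (Fin d × Fin d × Fin d)).biUnion
        fun p => errPos k (F p.1 p.2.1) (A p.2.1 p.2.2))
      (BadN' := fun x => BadN x ∨ ∃ ab ∈ (univ : Finset (Fin d × Fin d)),
        Accepts (closure r l (C ab.1 ab.2)) x ∧ ¬ Accepts (C ab.1 ab.2) x)
      subset_union_left
      (fun w _ => (subset_biUnion_of_mem
        (fun p : Fin d × Fin d × Fin d => errPos k (F p.1 p.2.1) (A p.2.1 p.2.2)) (mem_univ (a, w, b))).trans
          subset_union_right)
      (fun x hx => Or.inl hx) (fun x hx => Or.inr ⟨(a, b), mem_univ _, by rw [hC]; exact hx⟩)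
    rw [← hC a b] at h
    exact h

/-- **`t` rounds of Bellman–Ford** from the exact start `reach₀(a,b) = [a = b]`: after `t` rounds all
`reach_t(a,b)` carry the wire invariant with `≤ t·d³·T` lost `k`-sets and gained mass `≤ (d² + t·d²)·Pl`
(the `d²` is the atom layer of the switched edges, whose plucking events form `N₀`). [folklore] -/
theorem bellmanFord_rounds (hr0 : 0 < r) (hq0 : 0 ≤ q) (hq1 : q ≤ 1)
    (hPl : ∀ 𝒞 : Finset (Finset (Fin m)), 𝒞 ⊆ smallSets (Fin m) l →
      prob q (fun x : KEdge m → Bool => Accepts (closure r l 𝒞) x ∧ ¬ Accepts 𝒞 x) ≤ Pl)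
    (hT : ∀ A B : Finset (Finset (Fin m)), IsClosedFamily r l A → IsClosedFamily r l B →
      #(errPos k A B) ≤ T)
    {e : Fin d → Fin d → (KEdge m → Bool) → Bool} {A : Fin d → Fin d → Finset (Finset (Fin m))}
    {N₀ : (KEdge m → Bool) → Prop} (hN₀ : prob q N₀ ≤ (d : ℝ) ^ 2 * Pl)
    (hA : ∀ (BadP : Finset (Finset (Fin m))) (BadN : (KEdge m → Bool) → Prop),
      (∀ x, N₀ x → BadN x) → ∀ a b, IsClosedFamily r l (A a b) ∧
        (∀ x : KEdge m → Bool, ¬ BadN x → Accepts (A a b) x → e a b x = true) ∧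
        ∀ S : Finset (Fin m), #S = k → e a b (cliqueVec S) = true →
          Accepts (A a b) (cliqueVec S) ∨ S ∈ BadP)
    (reach : ℕ → Fin d → Fin d → (KEdge m → Bool) → Bool)
    (hreach0 : ∀ a b x, reach 0 a b x = true ↔ a = b)
    (hreachS : ∀ t a b x, reach (t + 1) a b x = true ↔
      reach t a b x = true ∨ ∃ w ∈ (univ : Finset (Fin d)), reach t a w x = true ∧ e w b x = true) :
    ∀ t : ℕ, ∃ (F : Fin d → Fin d → Finset (Finset (Fin m))) (BadP : Finset (Finset (Fin m)))
      (BadN : (KEdge m → Bool) → Prop),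
      #BadP ≤ t * d ^ 3 * T ∧ prob q BadN ≤ ((d : ℝ) ^ 2 + t * (d : ℝ) ^ 2) * Pl ∧
      (∀ x, N₀ x → BadN x) ∧
      ∀ a b, IsClosedFamily r l (F a b) ∧
        (∀ x : KEdge m → Bool, ¬ BadN x → Accepts (F a b) x → reach t a b x = true) ∧
        ∀ S : Finset (Fin m), #S = k → reach t a b (cliqueVec S) = true →
          Accepts (F a b) (cliqueVec S) ∨ S ∈ BadP := by
  classical
  intro t
  induction t with
  | zero =>
    refine ⟨fun a b => if a = b then smallSets (Fin m) l else ∅, ∅, N₀, by simp, by simpa using hN₀,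
      fun _ h => h, fun a b => ⟨?_, fun x _ hacc => ?_, fun S _ hS => ?_⟩⟩
    · by_cases hab : a = b
      · simp only [hab, if_true]
        exact isClosedFamily_smallSets r l
      · simp only [hab, if_false]
        exact isClosedFamily_empty' hr0 l
    · by_cases hab : a = b
      · exact (hreach0 a b x).2 hab
      · simp only [hab, if_false] at hacc
        obtain ⟨W, hW, -⟩ := hacc
        exact absurd hW (notMem_empty W)
    · simp only [(hreach0 a b _).1 hS, if_true]
      exact Or.inl ⟨∅, empty_mem_smallSets l, cliquePresent_empty _⟩
  | succ t ih =>
    obtain ⟨F, BadP, BadN, hcP, hcN, hN0, hinv⟩ := ih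
    obtain ⟨F', BadP', BadN', hcP', hcN', hNN, hinv'⟩ := bellmanFord_step hq0 hq1 hPl hT
      (hA BadP BadN hN0) hinv (hreachS t) (fun a b => F a b ∪ (univ : Finset (Fin d)).biUnion fun w => F a w ∩ A w b)
      (fun _ _ => rfl)
    refine ⟨F', BadP', BadN', ?_, ?_, fun x hx => hNN x (hN0 x hx), hinv'⟩
    · calc #BadP' ≤ #BadP + d ^ 3 * T := hcP'
        _ ≤ t * d ^ 3 * T + d ^ 3 * T := Nat.add_le_add_right hcP _
        _ = (t + 1) * d ^ 3 * T := by ring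
    · calc prob q BadN' ≤ prob q BadN + (d : ℝ) ^ 2 * Pl := hcN'
        _ ≤ ((d : ℝ) ^ 2 + t * (d : ℝ) ^ 2) * Pl + (d : ℝ) ^ 2 * Pl := by linarith
        _ = ((d : ℝ) ^ 2 + (t + 1 : ℕ) * (d : ℝ) ^ 2) * Pl := by push_cast; ring

end BellmanFord

/-! ### The door: SG for transposition term gates, with explicit budgets -/

/-- **SG for one transposition term gate (explicit budgets).** Let `O(x) = [τ ∈ ⟨σ i : ⌈X i⌉(x)⟩]` be a
permutation-group-membership term gate on `d` points whose generators are transpositions (or trivial),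
fed with clique atoms `⌈X i⌉`, `X i ∈ 𝒱(l)`, of any fan-in. If plucking any `𝒞 ⊆ 𝒱(l)` costs `≤ Pl` and
trimming two closed families loses `≤ T` bare `k`-cliques, then some `𝒜 ⊆ 𝒱(l)` approximates `O`
one-sidedly with `#lostPos ≤ (d⁴ + d)·T` and `gainedNeg ≤ (d² + d³)·Pl`. Proof: Bellman–Ford in the
lattice `K(m,r,l)` — the switched edge `{a,b}` is the atom-OR `⌈{X i : σ i = (a b)}⌉` (one pluck each,
`inv_atomOr`), `d` rounds of `reach_{t+1}(a,b) = reach_t(a,b) ∨ ⋁_w reach_t(a,w) ∧ edge(w,b)`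
(`bellmanFord_rounds`), and the output `⋀_a reach_d(a, τ a)` (`mem_closure_image_iff_forall_reachable`,
paths have length `< d`; `inv_bigAnd`). [folklore] -/
theorem sg_transpositionTermGate_of_budget (m r l k d n T : ℕ) (q Pl : ℝ) (hr : 2 ≤ r)
    (hq0 : 0 ≤ q) (hq1 : q ≤ 1)
    (hPl : ∀ 𝒞 : Finset (Finset (Fin m)), 𝒞 ⊆ smallSets (Fin m) l →
      prob q (fun x : KEdge m → Bool => Accepts (closure r l 𝒞) x ∧ ¬ Accepts 𝒞 x) ≤ Pl)
    (hT : ∀ A B : Finset (Finset (Fin m)), IsClosedFamily r l A → IsClosedFamily r l B →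
      #(errPos k A B) ≤ T)
    (σ : Fin n → Equiv.Perm (Fin d)) (τ : Equiv.Perm (Fin d)) (hσ : ∀ i, σ i = 1 ∨ (σ i).IsSwap)
    (X : Fin n → Finset (Fin m)) (hX : ∀ i, X i ∈ smallSets (Fin m) l)
    (O : (KEdge m → Bool) → Bool)
    (hO : ∀ x, O x = true ↔ τ ∈ Subgroup.closure (σ '' {i | atomB (X i) x = true})) :
    ∃ 𝒜 ⊆ smallSets (Fin m) l,
      #(lostPos m k O 𝒜) ≤ (d ^ 4 + d) * T ∧ gainedNeg m q O 𝒜 ≤ ((d : ℝ) ^ 2 + (d : ℝ) ^ 3) * Pl := by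
  classical
  have hr0 : 0 < r := by omega
  -- the switched graph on the `d` points, bounded reachability, the atom-ORs of the edges
  set Gx : (KEdge m → Bool) → SimpleGraph (Fin d) := fun x =>
    SimpleGraph.fromRel fun a b : Fin d => ∃ i ∈ {i | atomB (X i) x = true}, σ i = Equiv.swap a b
    with hGx
  set reach : ℕ → Fin d → Fin d → (KEdge m → Bool) → Bool := fun t a b x =>
    decide (∃ w : (Gx x).Walk a b, w.length ≤ t) with hreach
  set 𝓗 : Fin d → Fin d → Finset (Finset (Fin m)) := fun a b =>
    (univ.filter fun i => σ i = Equiv.swap a b).image X with h𝓗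
  set e : Fin d → Fin d → (KEdge m → Bool) → Bool := fun a b x => decide (Accepts (𝓗 a b) x) with he
  set A : Fin d → Fin d → Finset (Finset (Fin m)) := fun a b => closure r l (𝓗 a b) with hA
  set N₀ : (KEdge m → Bool) → Prop := fun x => ∃ ab ∈ (univ : Finset (Fin d × Fin d)),
    Accepts (closure r l (𝓗 ab.1 ab.2)) x ∧ ¬ Accepts (𝓗 ab.1 ab.2) x with hN₀
  have h𝓗sub : ∀ a b, 𝓗 a b ⊆ smallSets (Fin m) l := fun a b => by
    intro W hW
    obtain ⟨i, -, rfl⟩ := mem_image.1 hW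
    exact hX i
  have h𝓗acc : ∀ a b x, Accepts (𝓗 a b) x ↔ ∃ i, atomB (X i) x = true ∧ σ i = Equiv.swap a b := by
    intro a b x
    constructor
    · rintro ⟨W, hW, hWx⟩
      obtain ⟨i, hi, rfl⟩ := mem_image.1 hW
      exact ⟨i, by simpa [atomB] using hWx, (mem_filter.1 hi).2⟩
    · rintro ⟨i, hix, hiσ⟩
      exact ⟨X i, mem_image.2 ⟨i, mem_filter.2 ⟨mem_univ _, hiσ⟩, rfl⟩, by simpa [atomB] using hix⟩
  have hN₀prob : prob q N₀ ≤ (d : ℝ) ^ 2 * Pl := by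
    calc prob q N₀ ≤ ∑ ab ∈ (univ : Finset (Fin d × Fin d)),
          prob q (fun x : KEdge m → Bool =>
            Accepts (closure r l (𝓗 ab.1 ab.2)) x ∧ ¬ Accepts (𝓗 ab.1 ab.2) x) :=
          prob_exists_le hq0 hq1 (univ : Finset (Fin d × Fin d)) (fun (ab : Fin d × Fin d)
            (x : KEdge m → Bool) => Accepts (closure r l (𝓗 ab.1 ab.2)) x ∧ ¬ Accepts (𝓗 ab.1 ab.2) x)
      _ ≤ ∑ _ab ∈ (univ : Finset (Fin d × Fin d)), Pl := sum_le_sum fun ab _ => hPl _ (h𝓗sub _ _)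
      _ = (d : ℝ) ^ 2 * Pl := by
          rw [sum_const, card_univ, Fintype.card_prod, Fintype.card_fin, nsmul_eq_mul]
          push_cast; ring
  have hAinv : ∀ (BadP : Finset (Finset (Fin m))) (BadN : (KEdge m → Bool) → Prop),
      (∀ x, N₀ x → BadN x) → ∀ a b,
      IsClosedFamily r l (A a b) ∧
        (∀ x : KEdge m → Bool, ¬ BadN x → Accepts (A a b) x → e a b x = true) ∧
        ∀ S : Finset (Fin m), #S = k → e a b (cliqueVec S) = true →
          Accepts (A a b) (cliqueVec S) ∨ S ∈ BadP := fun BadP BadN hN a b =>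
    inv_atomOr (h𝓗sub a b) (fun x => by simp [he]) BadP fun x hx => hN x ⟨(a, b), mem_univ _, hx⟩
  have hreach0 : ∀ a b x, reach 0 a b x = true ↔ a = b := by
    intro a b x
    simp only [hreach, decide_eq_true_eq, Nat.le_zero]
    constructor
    · rintro ⟨w, hw⟩
      exact SimpleGraph.Walk.eq_of_length_eq_zero hw
    · rintro rfl
      exact ⟨SimpleGraph.Walk.nil, rfl⟩
  have hreachS : ∀ t a b x, reach (t + 1) a b x = true ↔
      reach t a b x = true ∨ ∃ w ∈ (univ : Finset (Fin d)), reach t a w x = true ∧ e w b x = true := by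
    intro t a b x
    simp only [hreach, he, decide_eq_true_eq, mem_univ, true_and]
    rw [exists_walk_length_le_succ_iff]
    have hadj : ∀ c, (Gx x).Adj c b ↔ c ≠ b ∧ Accepts (𝓗 c b) x := by
      intro c
      rw [h𝓗acc, hGx, SimpleGraph.fromRel_adj]
      simp only [Set.mem_setOf_eq]
      constructor
      · rintro ⟨hne, ⟨i, hi, hiσ⟩ | ⟨i, hi, hiσ⟩⟩
        · exact ⟨hne, i, hi, hiσ⟩
        · exact ⟨hne, i, hi, by rw [hiσ, Equiv.swap_comm]⟩
      · rintro ⟨hne, i, hi, hiσ⟩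
        exact ⟨hne, Or.inl ⟨i, hi, hiσ⟩⟩
    simp only [hadj]
    constructor
    · rintro (h | ⟨c, hc, -, hcb⟩)
      · exact Or.inl h
      · exact Or.inr ⟨c, hc, hcb⟩
    · rintro (h | ⟨c, hc, hcb⟩)
      · exact Or.inl h
      · by_cases hcb' : c = b
        · subst hcb'
          exact Or.inl hc
        · exact Or.inr ⟨c, hc, hcb', hcb⟩
  -- `d` rounds of Bellman–Ford, then the output `O = ⋀_a reach_d (a, τ a)`
  obtain ⟨F, BadP, BadN, hcP, hcN, -, hinv⟩ :=
    bellmanFord_rounds hr0 hq0 hq1 hPl hT hN₀prob hAinv reach hreach0 hreachS d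
  obtain ⟨G, E, hE, hG⟩ := inv_bigAnd T hT (univ : Finset (Fin d)) (v := fun a => reach d a (τ a))
    (F := fun a => F a (τ a)) (BadP := BadP) (BadN := BadN) fun a _ => hinv a (τ a)
  have hOiff : ∀ x, O x = true ↔ ∀ a ∈ (univ : Finset (Fin d)), reach d a (τ a) x = true := by
    intro x
    rw [hO x, mem_closure_image_iff_forall_reachable σ hσ]
    simp only [hreach, decide_eq_true_eq, mem_univ, true_imp_iff]
    refine forall_congr' fun a => ⟨fun h => ?_, fun ⟨w, _⟩ => ⟨w⟩⟩
    obtain ⟨w, hw⟩ := exists_walk_length_le_card h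
    exact ⟨w, hw.trans (by simp)⟩
  refine ⟨G, hG.1.subset, ?_, ?_⟩
  · -- lost cliques
    have hsub : lostPos m k O G ⊆ BadP ∪ E := fun S hS => by
      simp only [lostPos, mem_filter, mem_powersetCard] at hS
      obtain ⟨⟨-, hSk⟩, hOS, hacc⟩ := hS
      exact (hG.2.2 S hSk (@decide_eq_true _ (_) ((hOiff _).1 hOS))).resolve_left hacc
    calc #(lostPos m k O G) ≤ #(BadP ∪ E) := card_le_card hsub
      _ ≤ #BadP + #E := card_union_le _ _
      _ ≤ d * d ^ 3 * T + (univ : Finset (Fin d)).card * T := Nat.add_le_add hcP hE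
      _ = (d ^ 4 + d) * T := by rw [card_univ, Fintype.card_fin]; ring
  · -- gained graphs
    calc gainedNeg m q O G ≤ prob q BadN := by
          refine prob_mono hq0 hq1 fun x hx => ?_
          by_contra hB
          have h1 := (hOiff x).2 (@of_decide_eq_true _ (_) (hG.2.1 x hB hx.2))
          rw [hx.1] at h1
          exact Bool.false_ne_true h1
      _ ≤ ((d : ℝ) ^ 2 + d * (d : ℝ) ^ 2) * Pl := hcN
      _ = ((d : ℝ) ^ 2 + (d : ℝ) ^ 3) * Pl := by ring

/-! ### The door in the line's regime: every `c` -/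

/-- **THE TRANSPOSITION DOOR (all `c`).** In the regime of the line (`δ = 1/8`: `k = ⌈m^{1/8}⌉`,
`l = ⌊√(k/(4 log₂ m + 1))⌋`, `q = 1 - 4 ln m/k`, `ε = m^{-(c+1)}/4`) the single-gate statement `SGAt` holds,
for EVERY `c`, for the sub-class of `PERM_{m^c}` term gates whose generators are transpositions (monotone
switching networks with `≤ m^c` nodes whose contacts are switched by clique atoms). Proof:
`sg_transpositionTermGate_of_budget` with `r = rOf (5c+1) m`, plucking `stub_pluckingBound` and trimming
`card_errPos_le_wide`, both within `ε_{5c+1}(m)` by `stub_denseRegime (5c+1)`, and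
`2 m^{4c} ε_{5c+1}(m) ≤ ε_c(m)`. This is the first door of the crux that is not capped below `m^{7/8}`:
it covers dimension `m^c` for all `c`, because shared sub-results of the Bellman–Ford program are charged
once (no union bound over the gate's truth table). [folklore] -/
theorem sgAt_transpositionPerm : ∀ c : ℕ, ∀ᶠ m : ℕ in atTop, SGAt m (fun g : GateFn => ∃ d : ℕ, d ≤ m ^ c ∧ ∃ (σ : Fin g.1 → Equiv.Perm (Fin d)) (τ : Equiv.Perm (Fin d)), (∀ i, σ i = 1 ∨ (σ i).IsSwap) ∧ ∀ v : Fin g.1 → Bool, g.2 v = true ↔ τ ∈ Subgroup.closure (σ '' {i | v i = true})) (lOf m) (kOf m) (qOf m) (epsOf c m) := by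
  intro c
  filter_upwards [stub_denseRegime (5 * c + 1), eventually_ge_atTop 2] with m hR hm2 O hO
  obtain ⟨-, hr, -, hq0, hq1, hpl, hand, -, -, -⟩ := hR
  obtain ⟨g, ⟨d, hd, σ, τ, hσ, hg⟩, X, hX, hOg⟩ := hO
  obtain ⟨𝒜, h𝒜, hlost, hgain⟩ := sg_transpositionTermGate_of_budget m (rOf (5 * c + 1) m) (lOf m) (kOf m) d
    g.1 (((rOf (5 * c + 1) m - 1) ^ lOf m) ^ 2 * (m - (lOf m + 1)).choose (kOf m - (lOf m + 1))) (qOf m)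
    ((#(smallSets (Fin m) (lOf m)) : ℝ) * (1 - qOf m ^ ((lOf m).choose 2)) ^ rOf (5 * c + 1) m) hr hq0 hq1
    (fun 𝒞 h𝒞 => stub_pluckingBound m _ _ _ hq0 hq1 𝒞 h𝒞) (fun A B hA hB => card_errPos_le_wide hr hA hB)
    σ τ hσ X hX O (fun x => by rw [hOg x]; exact hg _)
  have hkey := two_mul_pow_mul_epsOf_le (c := c) hm2
  obtain ⟨hd4, hd23⟩ := pow_four_add_le hd
  have hd4' : ((d : ℝ) ^ 4 + d) ≤ 2 * ((m : ℝ) ^ c) ^ 4 := by exact_mod_cast hd4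
  have hd23' : ((d : ℝ) ^ 2 + (d : ℝ) ^ 3) ≤ 2 * ((m : ℝ) ^ c) ^ 4 := by exact_mod_cast hd23
  have hPl0 : 0 ≤ (#(smallSets (Fin m) (lOf m)) : ℝ) * (1 - qOf m ^ ((lOf m).choose 2)) ^ rOf (5 * c + 1) m :=
    mul_nonneg (Nat.cast_nonneg _) (pow_nonneg (sub_nonneg.2 (pow_le_one₀ hq0 hq1)) _)
  refine ⟨𝒜, h𝒜, ?_, ?_⟩
  · calc (#(lostPos m (kOf m) O 𝒜) : ℝ)
        ≤ ((d : ℝ) ^ 4 + d) * ((((rOf (5 * c + 1) m - 1) ^ lOf m) ^ 2 *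
            (m - (lOf m + 1)).choose (kOf m - (lOf m + 1)) : ℕ) : ℝ) := by exact_mod_cast hlost
      _ ≤ (2 * ((m : ℝ) ^ c) ^ 4) * (epsOf (5 * c + 1) m * (m.choose (kOf m) : ℝ)) :=
          mul_le_mul hd4' hand (Nat.cast_nonneg _) (by positivity)
      _ = (2 * ((m : ℝ) ^ c) ^ 4 * epsOf (5 * c + 1) m) * (m.choose (kOf m) : ℝ) := by ring
      _ ≤ epsOf c m * (m.choose (kOf m) : ℝ) := mul_le_mul_of_nonneg_right hkey (Nat.cast_nonneg _)
  · calc gainedNeg m (qOf m) O 𝒜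
        ≤ ((d : ℝ) ^ 2 + (d : ℝ) ^ 3) *
            ((#(smallSets (Fin m) (lOf m)) : ℝ) * (1 - qOf m ^ ((lOf m).choose 2)) ^ rOf (5 * c + 1) m) := hgain
      _ ≤ (2 * ((m : ℝ) ^ c) ^ 4) * epsOf (5 * c + 1) m := mul_le_mul hd23' hpl hPl0 (by positivity)
      _ ≤ epsOf c m := hkey

end Summit.PneNP.PneNP.Theorems

end
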